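import Literature.NumberTheory.GaloisRepresentations.ClosureValuation
import Literature.NumberTheory.EllipticCurves.SelmerInertia
import Literature.NumberTheory.EllipticCurves.SelmerInertiaProofs
import Literature.NumberTheory.EllipticCurves.GoodReductionInertia
import Literature.NumberTheory.EllipticCurves.VariableChangePointsMap
import Literature.NumberTheory.EllipticCurves.H1UnramifiedFiniteProofs
import Literature.NumberTheory.DiophantineGeometry.LocalReductionFiniteBadPlacesProofs
import Mathlib.Topology.Algebra.Valued.NormedValued
import HarnessLib

/-!
# Finiteness of the Selmer group (Silverman AEC Thm. X.4.2(b)): discharge of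
# `WeierstrassCurve.finite_selmerGroup`, via the reduction step of Cor. X.4.4

`Proofs` companion of `Literature/NumberTheory/EllipticCurves/Selmer.lean` (and of the named fact
(RED) of `SelmerInertia.lean`). It discharges

* `WeierstrassCurve.smul_localPoints_eq_of_mem_inertia` (`SelmerInertia`) — the "reduction
  modulo `v`" step (RED) in Silverman's proof of *The Arithmetic of Elliptic Curves*, 2nd ed.,
  Thm. X.4.2(b) / Cor. X.4.4 (and of Prop. VIII.1.5(b)): *for an elliptic curve `E/K` over a
  number field, a finite place `v` of good reduction with `v ∤ n`, a prime `𝔐` of the local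
  absolute integers `\bar 𝓞_v ⊆ K̄_v` above `𝓂_v`, `σ` in the inertia group `I_𝔐 ≤ Γ_{K_v}` and
  `P ∈ E(K̄_v)` with `n (P^σ - P) = O`, one has `P^σ = P`*
  (`WeierstrassCurve.smul_localPoints_eq_of_mem_inertia_holds`, §1–§3);
* `WeierstrassCurve.selmerGroup_le_h1Unramified` (`SelmerUnramified`) — **Cor. X.4.4**,
  `S^{(n)}(E/K) ⊆ H¹(G_{K̄/K}, E[n]; S)` for `S ⊇ {bad places} ∪ {v ∣ n}`
  (`WeierstrassCurve.selmerGroup_le_h1Unramified_holds`, §4): the cocycle computation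
  `SelmerInertia.selmerGroup_le_h1Unramified_of_facts` fed with its two local inputs, the
  local–global compatibility of inertia groups
  (`IsDedekindDomain.HeightOneSpectrum.exists_mem_inertia_apply_eq_holds`, file
  `SelmerInertiaProofs`; Neukirch, *ANT*, II (9.6)) and (RED);
* `WeierstrassCurve.finite_selmerGroup` (`Selmer`) — **Thm. X.4.2(b)**, the `n`-Selmer group of
  an elliptic curve over a number field is finite (`WeierstrassCurve.finite_selmerGroup_holds`,
  §4), assembled by `SelmerUnramified.finite_selmerGroup_of_le_h1Unramified` from Cor. X.4.4,
  **Lemma X.4.3** (`Literature.NumberTheory.EllipticCurves.finite_h1Unramified_holds`, file `H1UnramifiedFiniteProofs`: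
  inflation–restriction and Prop. VIII.1.6 via Kummer theory), the finiteness of the bad places
  (`finite_badPlaces_holds`, `LocalReductionFiniteBadPlacesProofs`, AEC VIII.1 Rem. 1.3), of
  `E[n]` (`finite_torsionPoints_holds`, AEC III.6.4) and the discreteness of `E(K̄)`
  (`isOpen_stabilizer_point_holds`), files `GaloisActionProofs`.

The elliptic-curve content of (RED) is the abstract theorem
`Literature.NumberTheory.EllipticCurves.map_eq_of_inertia_of_zsmul_sub_eq_zero` of file `GoodReductionInertia` (valued field
`(L, w)`, `w`-integral equation with `w Δ = 1`, isometric `σ` with `w (σ z - z) < 1` on integers,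
`w n = 1`; proved there from VII.3.1 in valuation form and two cases of VII.2.1). Here we supply
the number-field instance:

* §1 **the valuation `|·|_v` on `K̄_v`**: the spectral norm of the complete field `K_v` (Mathlib
  `spectralMulAlgNorm`; Neukirch, *ANT*, II (4.8)), packaged as an `ℝ≥0`-valued `Valuation`
  (`exists_spectralValuation`; no definition is introduced, the lemmas take a valuation `w`
  with `w = spectralNorm` as hypothesis). Restating the tree file
  `GaloisRepresentations/ClosureValuation`: `w` is `Γ_{K_v}`-invariant, its valuation ring is
  `\bar 𝓞_v`, a prime `𝔐` above `𝓂_v` is `{|b|_v < 1}`, and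
  `I_𝔐 = {σ : |σ x - x|_v < 1 for |x|_v ≤ 1}` (Neukirch II (9.3)); moreover `|n|_v = 1` for
  `v ∤ n`;
* §2 **a good model**: at a place of good reduction, a change of variables `C` over `K_v` carries
  `E_{K_v}` to the base change of an `𝓞_v`-equation `M` with unit discriminant (Mathlib
  `IsMinimal`/`integralModel`/`HasGoodReduction`, tree `localMinimalModel`), whose base change to
  `K̄_v` is `w`-integral (Mathlib `WeierstrassCurve.IsIntegral w.integer`) with `|Δ|_v = 1`;
* §3 **the discharge of (RED)**: the induced isomorphism `E(K̄_v) ≃ M(K̄_v)` (tree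
  `VariableChange.pointEquivBaseChange`) is `Γ_{K_v}`-equivariant (Silverman VII.§1, VIII.§1),
  and the abstract theorem applies;
* §4 **Cor. X.4.4 and Thm. X.4.2(b)**.

## References

* [SilvermanAEC2009] J. H. Silverman, *The Arithmetic of Elliptic Curves*, 2nd ed., GTM 106,
  Springer 2009: X.§4, Thm. 4.2(b), Lemma 4.3, Cor. 4.4 and the proof of Thm. 4.2(b); VIII.§1
  Prop. 1.4 (= VII.3.1(b)), proof of Prop. 1.5(b), Prop. 1.6; VII.§1–§2 (minimal equations,
  reduction modulo `𝔪_v`).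
* [NeukirchANT1999] J. Neukirch, *Algebraic Number Theory*, Grundlehren 322, Springer 1999,
  Ch. II Thm. (4.8) (unique extension of a complete valuation), Thm. (6.2) (its valuation ring is
  the integral closure), §9 (9.3) (inertia group `I_w`), Prop. (9.6).

## Mathlib / tree reuse

Mathlib: `spectralMulAlgNorm`, `spectralNorm_extends`, `isNonarchimedean_spectralNorm`,
`Valued.toNontriviallyNormedField` (scoped), `Valued.toNormedField.norm_le_one_iff`/
`one_le_norm_iff`, `valuedAdicCompletion_eq_valuation'`,
`WeierstrassCurve.exists_isMinimal`/`baseChange_integralModel_eq`/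
`hasGoodReduction_iff_isElliptic_reduction`, `map_baseChange`, `Affine.Point.map`.
Tree: `Literature.NumberTheory.GaloisRepresentations.mem_absIntegers_adicCompletion_iff`, `Literature.NumberTheory.GaloisRepresentations.mem_iff_spectralNorm_lt_one_adicCompletion`,
`Literature.NumberTheory.GaloisRepresentations.mem_inertia_iff_spectralNorm_adicCompletion`, `Literature.NumberTheory.GaloisRepresentations.spectralNorm_absoluteGaloisGroup_smul`
(`ClosureValuation`); `localAbsIntegers`, `localPrimesAbove`, `localPoints`,
`smul_localPoints_eq_of_mem_inertia`, `selmerGroup_le_h1Unramified_of_facts`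
(`SelmerInertia`/`Sha`); `exists_mem_inertia_apply_eq_holds` (`SelmerInertiaProofs`);
`localMinimalModel`, `HasGoodReductionAt`, `badPlaces`, `finite_badPlaces_holds`
(`LocalReduction`, `LocalReductionFiniteBadPlacesProofs`); `VariableChange.pointEquivBaseChange`,
`pointEquivBaseChange_map_algEquiv`, `Affine.Point.congrEquiv(_some/_zero)`
(`VariableChangePointsMap`); `Literature.NumberTheory.EllipticCurves.isIntegral_integer_of_val_le_one`,
`Literature.NumberTheory.EllipticCurves.map_eq_of_inertia_of_zsmul_sub_eq_zero` (`GoodReductionInertia`);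
`Literature.NumberTheory.EllipticCurves.finite_h1Unramified_holds` (`H1UnramifiedFiniteProofs`); `finite_torsionPoints_holds`,
`isOpen_stabilizer_point_holds` (`GaloisActionProofs`); `finite_selmerGroup_of_le_h1Unramified`
(`SelmerUnramified`).

## Design

No definitions. The valuation is produced existentially (`exists_spectralValuation`) with values
in `ℝ≥0` (rank one, as required by `GoodReductionInertia`); §1 lives in Mathlib's
`IsDedekindDomain.HeightOneSpectrum` namespace, §2–§4 are dot-notation extensions of
`WeierstrassCurve`. One universe `u` (`K : Type u`), as in `Sha`/`SelmerInertia`.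
-/

noncomputable section

open scoped Classical NNReal Valued Pointwise
open NumberField IsDedekindDomain Polynomial

universe u

namespace IsDedekindDomain.HeightOneSpectrum

open Literature.NumberTheory.EllipticCurves Literature.NumberTheory.GaloisRepresentations Field

variable {K : Type u} [Field K] [NumberField K] (v : HeightOneSpectrum (𝓞 K))

/-! ## The spectral valuation on `K̄_v` -/

/-- **The valuation `|·|_v` on `K̄_v`** (values in `ℝ≥0`): the spectral norm of the complete
non-archimedean field `K_v` on `K̄_v = AlgebraicClosure K_v` (Mathlib's multiplicative
`spectralMulAlgNorm`) is a valuation; the unique one extending that of `K_v`.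
Neukirch, *ANT*, Ch. II Thm. (4.8). [cite: NeukirchANT1999, Ch. II Thm. (4.8)] -/
theorem exists_spectralValuation :
    ∃ w : Valuation (AlgebraicClosure (v.adicCompletion K)) ℝ≥0,
      ∀ x, (w x : ℝ) = spectralNorm (v.adicCompletion K) (AlgebraicClosure (v.adicCompletion K)) x := by
  let N : MulAlgebraNorm (v.adicCompletion K) (AlgebraicClosure (v.adicCompletion K)) :=
    spectralMulAlgNorm (v.adicCompletion K) (AlgebraicClosure (v.adicCompletion K))
  refine ⟨{ toFun := fun x ↦ ⟨N x, apply_nonneg N x⟩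
            map_zero' := Subtype.ext (map_zero N)
            map_one' := Subtype.ext N.map_one'
            map_mul' := fun x y ↦ Subtype.ext (map_mul N x y)
            map_add_le_max' := fun x y ↦ ?_ }, fun x ↦ rfl⟩
  rw [← NNReal.coe_le_coe, NNReal.coe_max]
  exact isNonarchimedean_spectralNorm x y

section SpectralValuation

variable {v} {w : Valuation (AlgebraicClosure (v.adicCompletion K)) ℝ≥0}
  (hw : ∀ x, (w x : ℝ) = spectralNorm (v.adicCompletion K) (AlgebraicClosure (v.adicCompletion K)) x)
include hw

/-- The spectral valuation on `K̄_v` extends the norm of `K_v`. Neukirch, *ANT*, Ch. II (4.8).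
[folklore] -/
theorem coe_spectralValuation_algebraMap (a : v.adicCompletion K) :
    (w (algebraMap (v.adicCompletion K) _ a) : ℝ) = ‖a‖ := by
  rw [hw, spectralNorm_extends]

/-- An element of `K_v` has spectral valuation `≤ 1` in `K̄_v` iff it lies in `𝓞_v`. [folklore] -/
theorem spectralValuation_algebraMap_le_one_iff (a : v.adicCompletion K) :
    w (algebraMap (v.adicCompletion K) _ a) ≤ 1 ↔ a ∈ v.adicCompletionIntegers K := by
  rw [← NNReal.coe_le_coe, coe_spectralValuation_algebraMap hw, NNReal.coe_one,
    Valued.toNormedField.norm_le_one_iff, mem_adicCompletionIntegers]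

/-- **Galois invariance**: `|σ x|_v = |x|_v` for `σ ∈ Γ_{K_v}` (tree:
`Literature.NumberTheory.GaloisRepresentations.spectralNorm_absoluteGaloisGroup_smul`). Neukirch, *ANT*, Ch. II (4.8) and §9. [folklore] -/
theorem spectralValuation_smul (σ : absoluteGaloisGroup (v.adicCompletion K))
    (x : AlgebraicClosure (v.adicCompletion K)) : w (σ • x) = w x :=
  NNReal.coe_injective (by rw [hw, hw]; exact spectralNorm_absoluteGaloisGroup_smul σ x)

/-- **The local absolute integers are the valuation ring**: `x ∈ \bar 𝓞_v ↔ |x|_v ≤ 1` (tree: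
`Literature.NumberTheory.GaloisRepresentations.mem_absIntegers_adicCompletion_iff`). Neukirch, *ANT*, Ch. II Thm. (6.2). [folklore] -/
theorem mem_localAbsIntegers_iff_spectralValuation {x : AlgebraicClosure (v.adicCompletion K)} :
    x ∈ v.localAbsIntegers ↔ w x ≤ 1 := by
  rw [← NNReal.coe_le_coe, hw, NNReal.coe_one]
  exact mem_absIntegers_adicCompletion_iff v

/-- Membership in a prime of `\bar 𝓞_v` above `𝓂_v`: `b ∈ 𝔐 ↔ |b|_v < 1` (tree:
`Literature.NumberTheory.GaloisRepresentations.mem_iff_spectralNorm_lt_one_adicCompletion`; there is exactly one such prime).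
Neukirch, *ANT*, Ch. II (4.8), (6.2). [folklore] -/
theorem mem_iff_spectralValuation_lt_one {𝔐 : Ideal v.localAbsIntegers}
    (h𝔐 : 𝔐 ∈ v.localPrimesAbove) {b : v.localAbsIntegers} :
    b ∈ 𝔐 ↔ w (b : AlgebraicClosure (v.adicCompletion K)) < 1 := by
  haveI := h𝔐.1
  haveI := h𝔐.2
  rw [← NNReal.coe_lt_coe, hw, NNReal.coe_one]
  exact mem_iff_spectralNorm_lt_one_adicCompletion v b

/-- **The inertia group of `K̄_v/K_v`, valuation-theoretically** (tree:
`Literature.NumberTheory.GaloisRepresentations.mem_inertia_iff_spectralNorm_adicCompletion`): for a prime `𝔐` of `\bar 𝓞_v` above `𝓂_v`,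
`σ ∈ I_𝔐` iff `|σ x - x|_v < 1` for every `x` with `|x|_v ≤ 1`.
Neukirch, *ANT*, Ch. II §9 (9.3); Silverman, *AEC*, VIII.§2 and X.§4 (the inertia group `I_v`).
[folklore] -/
theorem mem_inertia_iff_spectralValuation {𝔐 : Ideal v.localAbsIntegers}
    (h𝔐 : 𝔐 ∈ v.localPrimesAbove) {σ : absoluteGaloisGroup (v.adicCompletion K)} :
    σ ∈ 𝔐.inertia (absoluteGaloisGroup (v.adicCompletion K)) ↔
      ∀ x : AlgebraicClosure (v.adicCompletion K), w x ≤ 1 → w (σ • x - x) < 1 := by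
  haveI := h𝔐.1
  haveI := h𝔐.2
  rw [mem_inertia_iff_spectralNorm_adicCompletion v]
  refine forall_congr' fun x ↦ ?_
  rw [← NNReal.coe_le_coe, ← NNReal.coe_lt_coe, hw, hw, NNReal.coe_one]

/-! ## Integers and units coming from `K` -/

omit hw in
/-- The structure map `𝓞 K → K̄_v` factors through `K → K_v`. [folklore] -/
theorem algebraMap_ringOfIntegers_algClosure_apply (x : 𝓞 K) :
    algebraMap (𝓞 K) (AlgebraicClosure (v.adicCompletion K)) x =
      algebraMap (v.adicCompletion K) (AlgebraicClosure (v.adicCompletion K))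
        ((algebraMap (𝓞 K) K x : K) : v.adicCompletion K) := by
  rw [IsScalarTower.algebraMap_apply (𝓞 K) K (AlgebraicClosure (v.adicCompletion K)),
    IsScalarTower.algebraMap_apply K (v.adicCompletion K) (AlgebraicClosure (v.adicCompletion K))]
  rfl

/-- A global integer outside `v` is a `v`-adic unit: `|x|_v = 1` in `K̄_v` for `x ∈ 𝓞 K ∖ v`.
[folklore] -/
theorem spectralValuation_algebraMap_ringOfIntegers_eq_one {x : 𝓞 K} (hx : x ∉ v.asIdeal) :
    w (algebraMap (𝓞 K) (AlgebraicClosure (v.adicCompletion K)) x) = 1 := by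
  apply NNReal.coe_injective
  rw [algebraMap_ringOfIntegers_algClosure_apply, coe_spectralValuation_algebraMap hw,
    NNReal.coe_one]
  apply le_antisymm
  · rw [Valued.toNormedField.norm_le_one_iff, valuedAdicCompletion_eq_valuation']
    exact v.valuation_le_one x
  · rw [Valued.toNormedField.one_le_norm_iff, valuedAdicCompletion_eq_valuation']
    exact not_lt.mp (mt (v.valuation_lt_one_iff_mem x).mp hx)

/-- An integer `n` prime to `v` (`(n : 𝓞 K) ∉ v`) is a `v`-adic unit: `|n|_v = 1` in `K̄_v`.
Silverman, *AEC*, VII.3.1 / VIII.1.4 (the hypothesis "`v ∤ m`"). [folklore] -/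
theorem spectralValuation_intCast_eq_one {n : ℤ} (hn : (n : 𝓞 K) ∉ v.asIdeal) :
    w (n : AlgebraicClosure (v.adicCompletion K)) = 1 := by
  rw [← map_intCast (algebraMap (𝓞 K) (AlgebraicClosure (v.adicCompletion K))) n]
  exact spectralValuation_algebraMap_ringOfIntegers_eq_one hw hn

/-- A unit of `𝓞_v` has valuation `1` in `K̄_v`. [folklore] -/
theorem spectralValuation_eq_one_of_isUnit {a : v.adicCompletionIntegers K} (ha : IsUnit a) :
    w (algebraMap (v.adicCompletion K) (AlgebraicClosure (v.adicCompletion K))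
      (algebraMap (v.adicCompletionIntegers K) (v.adicCompletion K) a)) = 1 := by
  obtain ⟨u, rfl⟩ := ha
  set f : v.adicCompletionIntegers K →+* AlgebraicClosure (v.adicCompletion K) :=
    (algebraMap (v.adicCompletion K) (AlgebraicClosure (v.adicCompletion K))).comp
      (algebraMap (v.adicCompletionIntegers K) (v.adicCompletion K))
  have hle : ∀ a : v.adicCompletionIntegers K, w (f a) ≤ 1 :=
    fun a ↦ (spectralValuation_algebraMap_le_one_iff hw _).mpr a.2
  change w (f u) = 1
  refine le_antisymm (hle _) ?_
  have h1 : w (f u) * w (f ↑u⁻¹) = 1 := by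
    rw [← map_mul, ← map_mul, Units.mul_inv, map_one, map_one]
  calc (1 : ℝ≥0) = _ := h1.symm
    _ ≤ w (f u) := mul_le_of_le_one_right' (hle _)

end SpectralValuation

end IsDedekindDomain.HeightOneSpectrum

namespace WeierstrassCurve

open Literature.NumberTheory.EllipticCurves Literature.NumberTheory.GaloisRepresentations Field IsDedekindDomain.HeightOneSpectrum

variable {K : Type u} [Field K] [NumberField K] (W : WeierstrassCurve K)

/-! ## A good integral model at a place of good reduction -/

/-- At a place of good reduction there is a change of variables over `K_v` carrying `E/K_v` to
the base change of a Weierstrass equation over `𝓞_v` with unit discriminant (a minimal model,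
Silverman, *AEC*, VII.§1 and VII.5.1(a); Mathlib `exists_isMinimal`, `integralModel`,
`HasGoodReduction`; tree `localMinimalModel`). [folklore] -/
theorem exists_integralModel_of_hasGoodReductionAt {v : HeightOneSpectrum (𝓞 K)}
    (hv : W.HasGoodReductionAt v) :
    ∃ (C : VariableChange (v.adicCompletion K)) (M : WeierstrassCurve (v.adicCompletionIntegers K)),
      C • W.baseChange (v.adicCompletion K) =
          M.map (algebraMap (v.adicCompletionIntegers K) (v.adicCompletion K)) ∧
        IsUnit M.Δ := by
  haveI : (W.localMinimalModel v).HasGoodReduction (v.adicCompletionIntegers K) := hv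
  refine ⟨((W.baseChange (v.adicCompletion K)).exists_isMinimal (v.adicCompletionIntegers K)).choose,
    (W.localMinimalModel v).integralModel (v.adicCompletionIntegers K), ?_, ?_⟩
  · exact (baseChange_integralModel_eq (v.adicCompletionIntegers K) (W.localMinimalModel v)).symm
  · have hell := (hasGoodReduction_iff_isElliptic_reduction
      (R := v.adicCompletionIntegers K) (W := W.localMinimalModel v)).mp hv
    have hu := hell.isUnit
    rw [reduction, map_Δ] at hu
    exact (isUnit_map_iff (IsLocalRing.residue _) _).mp hu

section Model

variable {v : HeightOneSpectrum (𝓞 K)}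
  {w : Valuation (AlgebraicClosure (v.adicCompletion K)) ℝ≥0}
  (hw : ∀ x, (w x : ℝ) = spectralNorm (v.adicCompletion K) (AlgebraicClosure (v.adicCompletion K)) x)
include hw

omit W in
/-- The base change to `K̄_v` of a Weierstrass equation over `𝓞_v` is integral for the spectral
valuation (Mathlib `WeierstrassCurve.IsIntegral w.integer`). Silverman, *AEC*, VII.§1. [folklore] -/
theorem isIntegral_spectralValuation_baseChange
    (M : WeierstrassCurve (v.adicCompletionIntegers K)) :
    ((M.map (algebraMap (v.adicCompletionIntegers K) (v.adicCompletion K))).baseChange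
        (AlgebraicClosure (v.adicCompletion K))).IsIntegral w.integer := by
  have key : ∀ a : v.adicCompletionIntegers K,
      w (algebraMap (v.adicCompletion K) (AlgebraicClosure (v.adicCompletion K))
        (algebraMap (v.adicCompletionIntegers K) (v.adicCompletion K) a)) ≤ 1 :=
    fun a ↦ (spectralValuation_algebraMap_le_one_iff hw _).mpr a.2
  exact isIntegral_integer_of_val_le_one (key _) (key _) (key _) (key _) (key _)

omit W in
/-- The discriminant of the base change to `K̄_v` of an `𝓞_v`-model with unit discriminant has
spectral valuation `1`. [folklore] -/
theorem spectralValuation_Δ_baseChange {M : WeierstrassCurve (v.adicCompletionIntegers K)}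
    (hΔ : IsUnit M.Δ) :
    w ((M.map (algebraMap (v.adicCompletionIntegers K) (v.adicCompletion K))).baseChange
        (AlgebraicClosure (v.adicCompletion K))).Δ = 1 := by
  rw [baseChange, map_Δ, map_Δ]
  exact spectralValuation_eq_one_of_isUnit hw hΔ

end Model

/-! ## Transport of `E(K̄_v)` to the good model -/

variable (v : HeightOneSpectrum (𝓞 K))

/-- `(W_{K_v})_{K̄_v} = W_{K̄_v}`. [folklore] -/
theorem baseChange_baseChange_adicCompletion :
    (W.baseChange (v.adicCompletion K)).baseChange (AlgebraicClosure (v.adicCompletion K)) =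
      W.baseChange (AlgebraicClosure (v.adicCompletion K)) :=
  W.map_baseChange (Algebra.ofId (v.adicCompletion K) (AlgebraicClosure (v.adicCompletion K)))

/-- The transport `E(K̄_v) = W_{K̄_v}(K̄_v) → (W_{K_v})_{K̄_v}(K̄_v)` (identity on coordinates)
intertwines the action of `σ ∈ Γ_{K_v}` on `E(K̄_v)` (through `Aut_K(K̄_v)`, file `Sha`) with
`Point.map σ` (`σ` as a `K_v`-automorphism). Silverman, *AEC*, VIII.§1. [folklore] -/
theorem congrEquiv_smul (σ : absoluteGaloisGroup (v.adicCompletion K))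
    (P : localPoints W (v.adicCompletion K)) :
    Affine.Point.congrEquiv (baseChange_baseChange_adicCompletion W v).symm (σ • P) =
      Affine.Point.map ((absoluteGaloisGroup.toAlgEquiv _ σ :
          AlgebraicClosure (v.adicCompletion K) ≃ₐ[v.adicCompletion K]
            AlgebraicClosure (v.adicCompletion K)) :
          AlgebraicClosure (v.adicCompletion K) →ₐ[v.adicCompletion K]
            AlgebraicClosure (v.adicCompletion K))
        (Affine.Point.congrEquiv (baseChange_baseChange_adicCompletion W v).symm P) := by
  rcases P with _ | ⟨x, y, hxy⟩
  · change Affine.Point.congrEquiv _ (σ • (0 : localPoints W (v.adicCompletion K))) =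
      Affine.Point.map _ (Affine.Point.congrEquiv _ 0)
    rw [smul_zero, Affine.Point.congrEquiv_zero, map_zero]
    exact Affine.Point.congrEquiv_zero _
  · rw [localPoints.smul_def]
    change Affine.Point.congrEquiv _ (Affine.Point.map _ (Affine.Point.some x y hxy)) = _
    rw [Affine.Point.map_some, Affine.Point.congrEquiv_some, Affine.Point.congrEquiv_some,
      Affine.Point.map_some]
    rfl

omit [NumberField K] in
/-- Transport along an equality `W₁ = W₂` of Weierstrass equations over `F₀` commutes with the maps
on `L`-points induced by `F₀`-algebra homomorphisms (both are the identity on coordinates).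
[folklore] -/
theorem _root_.WeierstrassCurve.Affine.Point.congrEquiv_baseChange_map {F₀ : Type*} [CommRing F₀]
    {W₁ W₂ : WeierstrassCurve F₀} (h : W₁ = W₂) {L L' : Type*} [Field L] [Field L']
    [Algebra F₀ L] [Algebra F₀ L'] [DecidableEq L] [DecidableEq L'] (f : L →ₐ[F₀] L')
    (P : (W₁.baseChange L).toAffine.Point) :
    Affine.Point.congrEquiv (congrArg (fun X : WeierstrassCurve F₀ ↦ X.baseChange L') h)
        (Affine.Point.map f P) =
      Affine.Point.map f
        (Affine.Point.congrEquiv (congrArg (fun X : WeierstrassCurve F₀ ↦ X.baseChange L) h) P) := by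
  subst h
  rfl

/-! ## The discharge -/

/-- **Silverman, AEC X.§4 (proof of Thm. 4.2(b)), the reduction step — discharge of the named
fact `WeierstrassCurve.smul_localPoints_eq_of_mem_inertia` of `SelmerInertia`.** For an elliptic
curve `E/K` over a number field, a finite place `v` of good reduction with `v ∤ n`, a prime `𝔐`
of `\bar 𝓞_v` above `𝓂_v`, `σ` in the inertia group `I_𝔐 ≤ Γ_{K_v}` and `P ∈ E(K̄_v)` with
`n (P^σ - P) = O`, one has `P^σ = P`. Proof: move to a minimal (good) model `M` over `𝓞_v` by a
change of variables `C` over `K_v` — the induced isomorphism `E(K̄_v) ≃ M(K̄_v)` (tree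
`VariableChange.pointEquivBaseChange`, between two transports along equalities of equations) is
`Γ_{K_v}`-equivariant since `C` has coefficients in `K_v` — and apply
`Literature.NumberTheory.EllipticCurves.map_eq_of_inertia_of_zsmul_sub_eq_zero` (file `GoodReductionInertia`: VII.3.1 via division
polynomials and the relevant cases of VII.2.1) to `M_{K̄_v}` and the spectral valuation `|·|_v`
of `K̄_v` (§1–§2: `M_{K̄_v}` is integral with `|Δ|_v = 1`, `σ` is an isometry with
`|σ z - z|_v < 1` on integers, `|n|_v = 1`).
[cite: SilvermanAEC2009, X.§4 proof of Thm. 4.2(b), via VIII.1.4 = VII.3.1(b)] -/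
theorem smul_localPoints_eq_of_mem_inertia_holds : W.smul_localPoints_eq_of_mem_inertia := by
  intro _ v hv n hn 𝔐 h𝔐 σ hσ P hP
  have hgood : W.HasGoodReductionAt v := by
    by_contra h
    exact hv h
  obtain ⟨C, M, hCM, hΔ⟩ := exists_integralModel_of_hasGoodReductionAt W hgood
  obtain ⟨w, hw⟩ := v.exists_spectralValuation
  -- notation: `E = K_v`, `L = K̄_v`, `σE = σ` as a `K_v`-automorphism of `L`
  set E := v.adicCompletion K
  set L := AlgebraicClosure (v.adicCompletion K)
  set σE : L ≃ₐ[E] L := absoluteGaloisGroup.toAlgEquiv _ σ with hσE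
  have hσ₁ : ∀ z : L, w (σE z) = w z := fun z ↦ spectralValuation_smul hw σ z
  have hσ₂ : ∀ z : L, w z ≤ 1 → w (σE z - z) < 1 := (mem_inertia_iff_spectralValuation hw h𝔐).mp hσ
  have hn' : w (n : L) = 1 := spectralValuation_intCast_eq_one hw hn
  haveI := isIntegral_spectralValuation_baseChange hw M
  -- transport to the good model `M_{K_v} = C • W_{K_v}`, equivariantly
  have hCM' := congrArg (fun X : WeierstrassCurve E ↦ X.baseChange L) hCM
  let Φ : localPoints W E ≃+
      ((M.map (algebraMap (v.adicCompletionIntegers K) E)).baseChange L).toAffine.Point :=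
    ((Affine.Point.congrEquiv (baseChange_baseChange_adicCompletion W v).symm).trans
      (VariableChange.pointEquivBaseChange (W.baseChange E) C L)).trans
      (Affine.Point.congrEquiv hCM')
  have hΦ : ∀ Q : localPoints W E, Φ (σ • Q) = Affine.Point.map (σE : L →ₐ[E] L) (Φ Q) := by
    intro Q
    change Affine.Point.congrEquiv hCM' (VariableChange.pointEquivBaseChange (W.baseChange E) C L
        (Affine.Point.congrEquiv (baseChange_baseChange_adicCompletion W v).symm (σ • Q))) =
      Affine.Point.map (σE : L →ₐ[E] L) (Affine.Point.congrEquiv hCM'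
        (VariableChange.pointEquivBaseChange (W.baseChange E) C L
          (Affine.Point.congrEquiv (baseChange_baseChange_adicCompletion W v).symm Q)))
    rw [congrEquiv_smul, VariableChange.pointEquivBaseChange_map_algEquiv, hσE]
    exact Affine.Point.congrEquiv_baseChange_map hCM _ _
  have key := Literature.NumberTheory.EllipticCurves.map_eq_of_inertia_of_zsmul_sub_eq_zero (w := w)
    (M.map (algebraMap (v.adicCompletionIntegers K) E))
    (spectralValuation_Δ_baseChange hw hΔ) σE hσ₁ hσ₂ hn' (P := Φ P) (by
      rw [← hΦ, ← map_sub, ← map_zsmul, hP, map_zero])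
  apply Φ.injective
  rw [hΦ]
  exact key

/-! ## Cor. X.4.4 and Thm. X.4.2(b) -/

/-- **Silverman, AEC Cor. X.4.4** (discharge of the named fact
`WeierstrassCurve.selmerGroup_le_h1Unramified` of `SelmerUnramified`): for an elliptic curve `E/K`
over a number field, `n ≠ 0` and a set `S` of finite places containing the places of bad reduction
and the places dividing `n`, `S^{(n)}(E/K) ⊆ H¹(G_{K̄/K}, E[n]; S)`, i.e. Selmer classes are
unramified outside `S`. Proof: `selmerGroup_le_h1Unramified_of_facts` (`SelmerInertia`) with the
proved local–global inertia compatibility (`exists_mem_inertia_apply_eq_holds`) and the proved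
reduction step (`smul_localPoints_eq_of_mem_inertia_holds`).
[cite: SilvermanAEC2009, Cor. X.4.4] -/
theorem selmerGroup_le_h1Unramified_holds : W.selmerGroup_le_h1Unramified :=
  selmerGroup_le_h1Unramified_of_facts
    (fun v ↦ IsDedekindDomain.HeightOneSpectrum.exists_mem_inertia_apply_eq_holds v)
    W.smul_localPoints_eq_of_mem_inertia_holds

/-- **Silverman, AEC Thm. X.4.2(b): the `n`-Selmer group of an elliptic curve over a number field
is finite** — discharge of the named fact `WeierstrassCurve.finite_selmerGroup` of `Selmer.lean`.
Proof as printed (X.§4): by Cor. X.4.4 (`selmerGroup_le_h1Unramified_holds`) the Selmer group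
lies in `H¹(G_{K̄/K}, E[n]; S)` for the finite set `S` of bad places and places dividing `n`
(`finite_badPlaces_holds`), which is finite by Lemma X.4.3 (`Literature.NumberTheory.EllipticCurves.finite_h1Unramified_holds`)
applied to the finite (`finite_torsionPoints_holds`, III.6.4) discrete
(`isOpen_stabilizer_point_holds`) `G_{K̄/K}`-module `E[n]`; assembled by
`finite_selmerGroup_of_le_h1Unramified` (`SelmerUnramified`).
[cite: SilvermanAEC2009, Thm. X.4.2(b)] -/
theorem finite_selmerGroup_holds : W.finite_selmerGroup :=
  W.finite_selmerGroup_of_le_h1Unramified (Literature.NumberTheory.EllipticCurves.finite_h1Unramified_holds K)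
    W.selmerGroup_le_h1Unramified_holds (W.finite_badPlaces_holds (𝓞 K))
    (W.finite_torsionPoints_holds (AlgebraicClosure K)) W.isOpen_stabilizer_point_holds

end WeierstrassCurve
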